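import Summits.BirchSwinnertonDyer.Rank2.CertifiedPartnerTypeAModelOne
import Summits.BirchSwinnertonDyer.Rank2.CertifiedPartnerTypeAModelThree
import Summits.BirchSwinnertonDyer.Rank2.CertifiedPartnerTypeANeighbourOne
import Summits.BirchSwinnertonDyer.Rank2.CertifiedPartnerTypeANeighbourThree
import Literature.NumberTheory.EllipticCurves.IsogenyTwoTorsionProofs
import Literature.NumberTheory.EllipticCurves.IsogenyVariableChangeProofs
import Literature.NumberTheory.EllipticCurves.IsogenyCompProofs
import Literature.NumberTheory.EllipticCurves.IsogenyDualProofs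
import HarnessLib

/-!
# Certified partners of Greenberg type A, II: the `2`-isogenies `W″_i ~ W′_i` (cell `bsd-rank2`)

Cell `bsd-rank2` (D-0036), seat `bsd-rank2-lit` GEN 18, stub `stub_partnerCF` (E1M line `cfsplit`, crux
`DepletedLambdaLawAtTwoMod`), TYPE A. For both branches of the type-A invariant (`D = 4i+1`:
`Rank2/CertifiedPartnerTypeAModelOne.lean` / `…NeighbourOne.lean`; `D = 4i+3`: `…ModelThree.lean` / `…NeighbourThree.lean`)
this file PROVES `IsIsogenous W″_i W′_i` through Silverman's explicit `2`-isogeny (tree theorem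
`isIsogenous_twoIsogenyCodomain`, III.4.5) between two changes of variables (eng-2's F1 idiom,
`Rank2/Family81517ReferenceIsogeny.lean`):

* `D = 4i+1`: `⟨2, 16i+25, 1, 12i+28⟩ • E₀ = W′_i` with `E₀ : y² = x³ + (24i+102)x² + (12i−45)²x`; the III.4.5 codomain of
  `E₀` is `E₁ : Y² = X³ − (48i+204)X² + 2304(4i+1)X = X(X−192)(X−12D)`; `⟨4, 0, 2, 0⟩ • E₁ = W″_i`.
* `D = 4i+3`: `⟨2, 16i+25, 1, 12i+28⟩ • E₀ = W′_i` with `E₀ : y² = x³ + (72i+86)x² + (36i+11)²x`; codomain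
  `E₁ : Y² = X³ − (144i+172)X² + 2304(4i+3)X = X(X−36D)(X−64)`; `⟨4, 0, 2, 0⟩ • E₁ = W″_i`.
So `W″_i = W′_i/⟨P′⟩` with `P′ = (−(16i+25)/4, ·)` the type-A point, and `IsIsogenous W″_i W′_i` by the dual isogeny
(`IsIsogenous.symm_of_charZero`).

PARTITION: none — r_an ≥ 2, summit axis S0; TWIN (D-0056): n/a. B1: explicit-model algebra; no `L`-function, no Selmer
group, no S0 motion. No named fact, no `sorry`.
-/

noncomputable section

namespace Summit.BirchSwinnertonDyer.Rank2

open _root_.WeierstrassCurve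
open Literature.NumberTheory.EllipticCurves

section NeighbourTypeAIsogeny

/-! ### Branch `D = 4i + 1` -/

/-- `⟨2, 16i+25, 1, 12i+28⟩ • E₀ = W′_i` (`D = 4i+1`). [cite: SilvermanAEC2009, III.1 (Table 3.1)] -/
theorem smul_twoTorsionNF_eq_partnerAOne (i : ℤ) :
    (⟨Units.mk0 (2 : ℚ) two_ne_zero, (16 * i + 25 : ℚ), 1, (12 * i + 28 : ℚ)⟩ : VariableChange ℚ) •
        (⟨0, (24 * i + 102 : ℚ), 0, ((12 * i - 45) ^ 2 : ℚ), 0⟩ : WeierstrassCurve ℚ) =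
      ⟨1, ((18 * i + 44 : ℤ) : ℚ), ((3 * i + 7 : ℤ) : ℚ), ((105 * i ^ 2 + 360 * i + 559 : ℤ) : ℚ),
        ((196 * i ^ 3 + 792 * i ^ 2 + 2052 * i + 2019 : ℤ) : ℚ)⟩ := by
  simp only [variableChange_def]
  ext <;> push_cast <;> norm_num <;> ring

/-- The III.4.5 codomain of `E₀` (`D = 4i+1`): `Y² = X³ − (48i+204)X² + 2304(4i+1)X`.
[cite: SilvermanAEC2009, III.4 Example 4.5] -/
theorem twoIsogenyCodomain_twoTorsionNF_AOne (i : ℤ) :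
    (⟨0, (24 * i + 102 : ℚ), 0, ((12 * i - 45) ^ 2 : ℚ), 0⟩ : WeierstrassCurve ℚ).twoIsogenyCodomain =
      ⟨0, (-(48 * i + 204) : ℚ), 0, (2304 * (4 * i + 1) : ℚ), 0⟩ := by
  simp only [twoIsogenyCodomain]
  ext <;> push_cast <;> ring

/-- `⟨4, 0, 2, 0⟩ • E₁ = W″_i` (`D = 4i+1`). [cite: SilvermanAEC2009, III.1 (Table 3.1)] -/
theorem smul_twoIsogenyCodomain_eq_neighbourAOne (i : ℤ) :
    (⟨Units.mk0 (4 : ℚ) four_ne_zero, 0, 2, 0⟩ : VariableChange ℚ) •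
        (⟨0, (-(48 * i + 204) : ℚ), 0, (2304 * (4 * i + 1) : ℚ), 0⟩ : WeierstrassCurve ℚ) =
      ⟨1, ((-3 * i - 13 : ℤ) : ℚ), ((0 : ℤ) : ℚ), ((36 * i + 9 : ℤ) : ℚ), ((0 : ℤ) : ℚ)⟩ := by
  simp only [variableChange_def]
  ext <;> push_cast <;> norm_num <;> ring

/-- `E₀` (`D = 4i+1`) is elliptic: `Δ(E₀) = 2¹²·Δ(W′_i)`. [cite: SilvermanAEC2009, III.4 Example 4.5] -/
theorem twoTorsionNF_AOne_isElliptic (i : ℤ) :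
    (⟨0, (24 * i + 102 : ℚ), 0, ((12 * i - 45) ^ 2 : ℚ), 0⟩ : WeierstrassCurve ℚ).IsElliptic := by
  refine ⟨isUnit_iff_ne_zero.mpr ?_⟩
  have hΔ : (⟨0, (24 * i + 102 : ℚ), 0, ((12 * i - 45) ^ 2 : ℚ), 0⟩ : WeierstrassCurve ℚ).Δ =
      ((4096 * (729 * (4 * i - 15) ^ 4 * (4 * i + 1)) : ℤ) : ℚ) := by
    simp only [WeierstrassCurve.Δ, WeierstrassCurve.b₂, WeierstrassCurve.b₄, WeierstrassCurve.b₆,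
      WeierstrassCurve.b₈]
    push_cast
    ring
  rw [hΔ]
  exact_mod_cast mul_ne_zero (by norm_num) (Δ_partnerAOne_ne_zero i)

/-- **`W′_i ~ W″_i`** (`D = 4i+1`): `W′_i ≅ E₀ → E₁ ≅ W″_i`, the middle arrow Silverman's `2`-isogeny with kernel
`⟨(0,0)⟩ = ⟨image of the type-A point (−(16i+25)/4, ·)⟩`. [cite: SilvermanAEC2009, III.4 Example 4.5] -/
theorem isIsogenous_partnerAOne_neighbourAOne (i : ℤ) :
    IsIsogenous
      (⟨1, ((18 * i + 44 : ℤ) : ℚ), ((3 * i + 7 : ℤ) : ℚ), ((105 * i ^ 2 + 360 * i + 559 : ℤ) : ℚ),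
        ((196 * i ^ 3 + 792 * i ^ 2 + 2052 * i + 2019 : ℤ) : ℚ)⟩ : WeierstrassCurve ℚ)
      (⟨1, ((-3 * i - 13 : ℤ) : ℚ), ((0 : ℤ) : ℚ), ((36 * i + 9 : ℤ) : ℚ), ((0 : ℤ) : ℚ)⟩ : WeierstrassCurve ℚ) := by
  haveI := twoTorsionNF_AOne_isElliptic i
  exact ((isIsogenous_of_smul_eq' (smul_twoTorsionNF_eq_partnerAOne i)).trans'
    (isIsogenous_of_eq_twoIsogenyCodomain _ (twoIsogenyCodomain_twoTorsionNF_AOne i))).trans'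
    (isIsogenous_of_smul_eq (smul_twoIsogenyCodomain_eq_neighbourAOne i))

/-- **`W″_i ~ W′_i`** (`D = 4i+1`), by the dual isogeny. [cite: SilvermanAEC2009, III.6.1 (dual isogeny)] -/
theorem isIsogenous_neighbourAOne_partnerAOne (i : ℤ) :
    IsIsogenous
      (⟨1, ((-3 * i - 13 : ℤ) : ℚ), ((0 : ℤ) : ℚ), ((36 * i + 9 : ℤ) : ℚ), ((0 : ℤ) : ℚ)⟩ : WeierstrassCurve ℚ)
      (⟨1, ((18 * i + 44 : ℤ) : ℚ), ((3 * i + 7 : ℤ) : ℚ), ((105 * i ^ 2 + 360 * i + 559 : ℤ) : ℚ),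
        ((196 * i ^ 3 + 792 * i ^ 2 + 2052 * i + 2019 : ℤ) : ℚ)⟩ : WeierstrassCurve ℚ) := by
  haveI := isElliptic_partnerAOne i
  haveI := isElliptic_neighbourAOne i
  exact (isIsogenous_partnerAOne_neighbourAOne i).symm_of_charZero

/-! ### Branch `D = 4i + 3` -/

/-- `⟨2, 16i+25, 1, 12i+28⟩ • E₀ = W′_i` (`D = 4i+3`). [cite: SilvermanAEC2009, III.1 (Table 3.1)] -/
theorem smul_twoTorsionNF_eq_partnerAThree (i : ℤ) :
    (⟨Units.mk0 (2 : ℚ) two_ne_zero, (16 * i + 25 : ℚ), 1, (12 * i + 28 : ℚ)⟩ : VariableChange ℚ) •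
        (⟨0, (72 * i + 86 : ℚ), 0, ((36 * i + 11) ^ 2 : ℚ), 0⟩ : WeierstrassCurve ℚ) =
      ⟨1, ((30 * i + 40 : ℤ) : ℚ), ((3 * i + 7 : ℤ) : ℚ), ((273 * i ^ 2 + 595 * i + 390 : ℤ) : ℚ),
        ((676 * i ^ 3 + 2246 * i ^ 2 + 2576 * i + 1119 : ℤ) : ℚ)⟩ := by
  simp only [variableChange_def]
  ext <;> push_cast <;> norm_num <;> ring

/-- The III.4.5 codomain of `E₀` (`D = 4i+3`): `Y² = X³ − (144i+172)X² + 2304(4i+3)X`.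
[cite: SilvermanAEC2009, III.4 Example 4.5] -/
theorem twoIsogenyCodomain_twoTorsionNF_AThree (i : ℤ) :
    (⟨0, (72 * i + 86 : ℚ), 0, ((36 * i + 11) ^ 2 : ℚ), 0⟩ : WeierstrassCurve ℚ).twoIsogenyCodomain =
      ⟨0, (-(144 * i + 172) : ℚ), 0, (2304 * (4 * i + 3) : ℚ), 0⟩ := by
  simp only [twoIsogenyCodomain]
  ext <;> push_cast <;> ring

/-- `⟨4, 0, 2, 0⟩ • E₁ = W″_i` (`D = 4i+3`). [cite: SilvermanAEC2009, III.1 (Table 3.1)] -/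
theorem smul_twoIsogenyCodomain_eq_neighbourAThree (i : ℤ) :
    (⟨Units.mk0 (4 : ℚ) four_ne_zero, 0, 2, 0⟩ : VariableChange ℚ) •
        (⟨0, (-(144 * i + 172) : ℚ), 0, (2304 * (4 * i + 3) : ℚ), 0⟩ : WeierstrassCurve ℚ) =
      ⟨1, ((-9 * i - 11 : ℤ) : ℚ), ((0 : ℤ) : ℚ), ((36 * i + 27 : ℤ) : ℚ), ((0 : ℤ) : ℚ)⟩ := by
  simp only [variableChange_def]
  ext <;> push_cast <;> norm_num <;> ring

/-- `E₀` (`D = 4i+3`) is elliptic: `Δ(E₀) = 2¹²·Δ(W′_i)`. [cite: SilvermanAEC2009, III.4 Example 4.5] -/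
theorem twoTorsionNF_AThree_isElliptic (i : ℤ) :
    (⟨0, (72 * i + 86 : ℚ), 0, ((36 * i + 11) ^ 2 : ℚ), 0⟩ : WeierstrassCurve ℚ).IsElliptic := by
  refine ⟨isUnit_iff_ne_zero.mpr ?_⟩
  have hΔ : (⟨0, (72 * i + 86 : ℚ), 0, ((36 * i + 11) ^ 2 : ℚ), 0⟩ : WeierstrassCurve ℚ).Δ =
      ((4096 * (9 * (4 * i + 3) * (36 * i + 11) ^ 4) : ℤ) : ℚ) := by
    simp only [WeierstrassCurve.Δ, WeierstrassCurve.b₂, WeierstrassCurve.b₄, WeierstrassCurve.b₆,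
      WeierstrassCurve.b₈]
    push_cast
    ring
  rw [hΔ]
  exact_mod_cast mul_ne_zero (by norm_num) (Δ_partnerAThree_ne_zero i)

/-- **`W′_i ~ W″_i`** (`D = 4i+3`). [cite: SilvermanAEC2009, III.4 Example 4.5] -/
theorem isIsogenous_partnerAThree_neighbourAThree (i : ℤ) :
    IsIsogenous
      (⟨1, ((30 * i + 40 : ℤ) : ℚ), ((3 * i + 7 : ℤ) : ℚ), ((273 * i ^ 2 + 595 * i + 390 : ℤ) : ℚ),
        ((676 * i ^ 3 + 2246 * i ^ 2 + 2576 * i + 1119 : ℤ) : ℚ)⟩ : WeierstrassCurve ℚ)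
      (⟨1, ((-9 * i - 11 : ℤ) : ℚ), ((0 : ℤ) : ℚ), ((36 * i + 27 : ℤ) : ℚ), ((0 : ℤ) : ℚ)⟩ : WeierstrassCurve ℚ) := by
  haveI := twoTorsionNF_AThree_isElliptic i
  exact ((isIsogenous_of_smul_eq' (smul_twoTorsionNF_eq_partnerAThree i)).trans'
    (isIsogenous_of_eq_twoIsogenyCodomain _ (twoIsogenyCodomain_twoTorsionNF_AThree i))).trans'
    (isIsogenous_of_smul_eq (smul_twoIsogenyCodomain_eq_neighbourAThree i))

/-- **`W″_i ~ W′_i`** (`D = 4i+3`), by the dual isogeny. [cite: SilvermanAEC2009, III.6.1 (dual isogeny)] -/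
theorem isIsogenous_neighbourAThree_partnerAThree (i : ℤ) :
    IsIsogenous
      (⟨1, ((-9 * i - 11 : ℤ) : ℚ), ((0 : ℤ) : ℚ), ((36 * i + 27 : ℤ) : ℚ), ((0 : ℤ) : ℚ)⟩ : WeierstrassCurve ℚ)
      (⟨1, ((30 * i + 40 : ℤ) : ℚ), ((3 * i + 7 : ℤ) : ℚ), ((273 * i ^ 2 + 595 * i + 390 : ℤ) : ℚ),
        ((676 * i ^ 3 + 2246 * i ^ 2 + 2576 * i + 1119 : ℤ) : ℚ)⟩ : WeierstrassCurve ℚ) := by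
  haveI := isElliptic_partnerAThree i
  haveI := isElliptic_neighbourAThree i
  exact (isIsogenous_partnerAThree_neighbourAThree i).symm_of_charZero

end NeighbourTypeAIsogeny

end Summit.BirchSwinnertonDyer.Rank2

end
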